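import Summits.HubbardSuperconductivity.HubbardSuperconductivity.Theses.ThermalWedge
import Summits.HubbardSuperconductivity.HubbardSuperconductivity.Theorems.ThermalWedgeTwSourcedInertnessLadder
import Summits.HubbardSuperconductivity.HubbardSuperconductivity.Theorems.ThermalWedgeTwSourcedInertnessReduction
import Summits.HubbardSuperconductivity.HubbardSuperconductivity.Theorems.ThermalWedgeTwSourcedCondensationFreeLinearThermalLaw
import Literature.MathematicalPhysics.QuantumLattice.DWaveSourceFreeGainBound
import Literature.MathematicalPhysics.QuantumLattice.GibbsPressureTemperature

/-!
# Crux `TwSourcedInertness` (item `stmt-HubbardSuperconductivity-1696`), line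
`temperature-for-source-exchange`: the crux modulo two INTERACTION CORRECTIONS

`--supports stmt-HubbardSuperconductivity-1696` file of the line lead; no definition is introduced.

`twSourcedInertness_of_corrections` (sorry-free): the dyadic temperature staircase
`Theorems.tw_staircase` fed with
* `anti` := Literature `log_partitionFn_div_antitone` (`β ↦ β⁻¹ log Z_β` antitone),
* `lip`  := Theorems `sourcedGain_le_linear` (`p̃_L(h) − p̃_L(0) ≤ 8√2|h|`),
* `lin`  := the FREE all-source bound (Literature `dWaveSource_free_sourcedGain_le`, `C₀(1+log β)s²`)
            plus hypothesis (D): the INTERACTION CORRECTION to the sourced gain on the thermal disc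
            `|h| ≤ c/β`, `[p̃_U(h) − p̃_0(h)] − [p̃_U(0) − p̃_0(0)] ≤ C_d(1+log β)h²`,
* `th`   := the FREE dyadic heat chord (Theorems `stub_freeLinearThermalLaw`, `≤ C₁/β²` at `h = 0`)
            plus hypothesis (T): the INTERACTION CORRECTION to the heat chord,
            `[p_U(β/2) − p_U(β)] − [p_0(β/2) − p_0(β)] ≤ C_t(1+log β)/β²` (`β ≥ 2`),
proves `TwSourcedInertness` with `U₀ = min`, `a = min`, `C = (C₀+C_d) + 4(C₁+C_t)/c² + 16√2/c`.
(D) and (T) are, verbatim, the registered stubs `stub_discCorrection` / `stub_thermalCorrection` of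
the line's skeleton (Cruxes/TwSourcedInertness/Lines/temperature_for_source_exchange.lean); both are
Benfatto–Giuliani–Mastropietro-2006-type statements (interacting `d`-wave pair susceptibility on the
thermal disc; interacting specific heat) at general filling, not in print.

Sources: G. Benfatto, A. Giuliani, V. Mastropietro, Ann. Henri Poincaré 7 (2006) 809, Thm 1.1 and
Remark 2 [BenfattoGiulianiMastropietro2006]; B. Simon, *The Statistical Mechanics of Lattice Gases* I
(1993) §II (convexity / monotonicity of the pressure in `β`) [folklore].
-/

noncomputable section

namespace Summit.HubbardSuperconductivity.HubbardSuperconductivity.Theorems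

open Matrix Finset Literature.MathematicalPhysics.QuantumLattice Literature.Probability.LatticeModels
open Summit.HubbardSuperconductivity.HubbardSuperconductivity.Theses.ThermalWedge

/-- **Composition of line `temperature-for-source-exchange`** (sorry-free): the two interaction
corrections (disc gain, dyadic heat chord) imply `TwSourcedInertness`, via the dyadic temperature
staircase `tw_staircase` fed with the tree's free inputs (`dWaveSource_free_sourcedGain_le`,
`stub_freeLinearThermalLaw`), antitonicity of `β ↦ β⁻¹ log Z_β` and the `8√2`-Lipschitz bound.
[folklore] -/
theorem twSourcedInertness_of_corrections :
    (∀ μ₁ μ₂ : ℝ, -4 < μ₁ → μ₁ ≤ μ₂ → μ₂ < 0 → ∃ U₀ a C c : ℝ, 0 < U₀ ∧ 0 < a ∧ 0 < C ∧ 0 < c ∧ ∀ U : ℝ, 0 < U → U ≤ U₀ → ∀ β : ℝ, 1 ≤ β → β ≤ Real.exp (a / U) → ∀ μ ∈ Set.Icc μ₁ μ₂, ∃ L₀ : ℕ, ∀ (L : ℕ) [NeZero L], L₀ ≤ L → ∀ h : ℝ, |h| ≤ c / β → (Real.log (Matrix.partitionFn β (Literature.MathematicalPhysics.QuantumLattice.dWaveSourceTorus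 L U μ h)).re / (β * (L : ℝ) ^ 2) - Real.log (Matrix.partitionFn β (Literature.MathematicalPhysics.QuantumLattice.dWaveSourceTorus L 0 μ h)).re / (β * (L : ℝ) ^ 2)) - (Real.log (Matrix.partitionFn β (Literature.MathematicalPhysics.QuantumLattice.dWaveSourceTorus L U μ 0)).re / (β * (L : ℝ) ^ 2) - Real.log (Matrix.partitionFn β (Literature.MathematicalPhysics.QuantumLattice.dWaveSourceTorus L 0 μ 0)).re / (β * (L : ℝ) ^ 2)) ≤ C * (1 + Real.log β) * h ^ 2) → (∀ μ₁ μ₂ : ℝ, -4 < μ₁ → μ₁ ≤ μ₂ → μ₂ < 0 → ∃ U₀ a C : ℝ, 0 < U₀ ∧ 0 < a ∧ 0 < C ∧ ∀ U : ℝ, 0 < U → U ≤ U₀ → ∀ β : ℝ, 2 ≤ β → β ≤ Real.exp (a / U) → ∀ μ ∈ Set.Icc μ₁ μ₂, ∃ L₀ : ℕ, ∀ (L : ℕ) [NeZero L], L₀ ≤ L → (Real.log (Matrix.partitionFn (β / 2) (Literature.MathematicalPhysics.QuantumLattice.hubbardTorusWith 2 L 1 U μ)).re / (β / 2 * (L :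 ℝ) ^ 2) - Real.log (Matrix.partitionFn β (Literature.MathematicalPhysics.QuantumLattice.hubbardTorusWith 2 L 1 U μ)).re / (β * (L : ℝ) ^ 2)) - (Real.log (Matrix.partitionFn (β / 2) (Literature.MathematicalPhysics.QuantumLattice.hubbardTorusWith 2 L 1 0 μ)).re / (β / 2 * (L : ℝ) ^ 2) - Real.log (Matrix.partitionFn β (Literature.MathematicalPhysics.QuantumLattice.hubbardTorusWith 2 L 1 0 μ)).re / (β * (L : ℝ) ^ 2)) ≤ C * (1 + Real.log β) / β ^ 2) → Summit.HubbardSuperconductivity.HubbardSuperconductivity.Theses.ThermalWedge.TwSourcedInertness := by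
  intro hD hT μ₁ μ₂ h4 h12 h0
  -- constants
  obtain ⟨C₀, hC₀, hFree⟩ := dWaveSource_free_sourcedGain_le μ₁ μ₂ h4 h12 h0
  obtain ⟨C₁, hC₁, hFreeTh⟩ := stub_freeLinearThermalLaw μ₁ μ₂ h4 h12 h0
  obtain ⟨U₀d, ad, Cd, c, hU₀d, had, hCd, hc, hDisc⟩ := hD μ₁ μ₂ h4 h12 h0
  obtain ⟨U₀t, at', Ct, hU₀t, hat, hCt, hTh⟩ := hT μ₁ μ₂ h4 h12 h0
  set A : ℝ := 8 * Real.sqrt 2 with hAdef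
  have hA : 0 ≤ A := by positivity
  refine ⟨min U₀d U₀t, min ad at', (C₀ + Cd) + 4 * (C₁ + Ct) / c ^ 2 + 2 * A / c,
    lt_min hU₀d hU₀t, lt_min had hat, by positivity, ?_⟩
  intro U hU hUle β hβ hβB μ hμ
  have hUd : U ≤ U₀d := hUle.trans (min_le_left _ _)
  have hUt : U ≤ U₀t := hUle.trans (min_le_right _ _)
  -- the staircase ceiling B := exp (min ad at' / U) is below both stub ceilings
  set B : ℝ := Real.exp (min ad at' / U) with hBdef
  have hBd : B ≤ Real.exp (ad / U) :=
    Real.exp_le_exp.mpr (div_le_div_of_nonneg_right (min_le_left _ _) hU.le)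
  have hBt : B ≤ Real.exp (at' / U) :=
    Real.exp_le_exp.mpr (div_le_div_of_nonneg_right (min_le_right _ _) hU.le)
  -- the staircase, for the sourced pressure of the interacting torus at fixed (U, μ)
  have key := tw_staircase
    (P := fun (L : ℕ) _ (b : ℝ) (h : ℝ) =>
      Real.log (partitionFn b (dWaveSourceTorus L U μ h)).re / (b * (L : ℝ) ^ 2))
    (B := B) (c := c) (C₁ := C₀ + Cd) (C₂ := C₁ + Ct) (A := A)
    hc (by positivity) (by positivity) hA ?anti ?lip ?lin ?th hβ hβB
  · simpa using key
  case anti =>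
    intro L _ b b' h hb' hle
    have hL : (0 : ℝ) < (L : ℝ) ^ 2 := cast_sq_pos_of_neZero L
    have h1 := log_partitionFn_div_antitone (isHermitian_dWaveSourceTorus L U μ h) hb' hle
    have h2 := div_le_div_of_nonneg_right h1 hL.le
    simpa only [div_div] using h2
  case lip =>
    intro L _ b h hb
    exact sourcedGain_le_linear L U μ (by linarith) h
  case lin =>
    intro b hb hbB
    obtain ⟨L₁, hL₁⟩ := hFree b hb μ hμ
    obtain ⟨L₂, hL₂⟩ := hDisc U hU hUd b hb (hbB.trans hBd) μ hμ
    refine ⟨max L₁ L₂, fun L _ hL h hh => ?_⟩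
    have hb0 : 0 < b := by linarith
    have hdisc : |h| ≤ c / b := by
      rw [le_div_iff₀ hb0]
      exact hh
    have h1 := hL₁ L (le_of_max_le_left hL) h
    have h2 := hL₂ L (le_of_max_le_right hL) h hdisc
    have : (C₀ + Cd) * (1 + Real.log b) * h ^ 2 =
        C₀ * (1 + Real.log b) * h ^ 2 + Cd * (1 + Real.log b) * h ^ 2 := by ring
    rw [this]
    linarith
  case th =>
    intro b hb hbB
    have hb1 : 1 ≤ b := by linarith
    obtain ⟨L₁, hL₁⟩ := hFreeTh b hb1 μ hμ
    obtain ⟨L₂, hL₂⟩ := hTh U hU hUt b hb (hbB.trans hBt) μ hμ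
    refine ⟨max L₁ L₂, fun L _ hL => ?_⟩
    have hb0 : 0 < b := by linarith
    have h1 := hL₁ L (le_of_max_le_left hL) 0 (by rw [abs_zero]; positivity)
    have h2 := hL₂ L (le_of_max_le_right hL)
    simp only [dWaveSourceTorus_zero] at h1 ⊢
    have : (C₁ + Ct) * (1 + Real.log b) / b ^ 2 =
        C₁ / b ^ 2 + Ct * (1 + Real.log b) / b ^ 2 + C₁ * Real.log b / b ^ 2 := by ring
    rw [this]
    have hextra : 0 ≤ C₁ * Real.log b / b ^ 2 := by
      have : 0 ≤ Real.log b := Real.log_nonneg hb1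
      positivity
    linarith

end Summit.HubbardSuperconductivity.HubbardSuperconductivity.Theorems
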